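import Summits.BirchSwinnertonDyer.Rank1Residual.X6.RankZeroCertificatePrasannaGuard
import Summits.BirchSwinnertonDyer.Rank1Residual.X6.RankZeroCertificateErratumRestCells
import Summits.BirchSwinnertonDyer.Rank1Residual.Supersingular.X6RankZeroErratumPack
import HarnessLib

/-!
# Class X6 ∧ analytic rank `0` — the ODD-ERRATUM-PRIME certificate of every record: 103 of the 107 Err records at
# `p ≥ 5` have an erratum prime `q ≠ 2`; the four `q = 2`-only records by name (`65774b1, 145146q1, 220022c1, 476882e1 @ 5`)

Cell `bsd-print-x6` (D-0131 (2) print tier, key `x6`; HOME `run/shared/lean/pub/bsd-print-x6/`), typer seat ty3 (gen 7; §5 appended gen 7).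
Sibling of `RankZeroCertificateErratum.lean` / `…ErratumDisplay.lean` (p548448 / p551397: the Bool certificates `Record.errAt`
/ `Record.restAt`, `HasErratumPrime` decided for all 734 records: 107 Err / 6 Rest at `p ≥ 5`) and of the inert-pair files
(p561444 `inertPairAt`, p574374 `inertPairCoprimeAt`, p575128 `prasannaGuardAt`). PARTITION (D-0054): leaf X6 ∧ r = 0
(K3 row A6) — types-the-object-of; closes NONE. HONEST FRAMING: nothing here asserts BSD or any `L`-value; every theorem
is a statement about the reduction types of an explicit minimal model at its bad primes, PROVED from kernel-rechecked
integer data — or (§1, last theorem) an implication from two NAMED published facts taken as hypotheses.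

WHY. The cell referee's ruling R-5.1 (HOME/REFEREE.md §2, 2026-08-27T21:29:01Z) separates the 107 Err census cells at
`p ≥ 5` into **the 103 whose erratum prime can be taken ODD** — closable by name through road (E) free of the second-level
rider `Cas18-Thm32-dK-odd@BDP13` (Castella 2018 Thm. 3.2 is typed parity-free, but its printed proof via [BDP13, Thm. 5.13]
is written for `d_K` odd; at the supply field of an ODD erratum prime `2` splits, so `d_K ≡ 1 (mod 8)` — ty2's
`X6RankZero.exists_erratumShapeField_oddDiscr_of_exists_odd`, p548175's pack file) — and **the 4 records whose only
erratum prime is `q = 2`** (referee census S-4: `65774b1, 145146q1, 220022c1, 476882e1`, all at `p = 5`), which stay on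
the rider. The Err certificate of p548448 does not record the parity of its witness. This file adds that column, decided
in the kernel for every record, in the shape ty2's corollary consumes:

* §1 the Bool certificates `Record.errOddAt` (some listed bad `(q, v)` with `q ≠ 2`, `q` certified NON-SPLIT, `p ∤ v`) and
  `Record.restOddAt` (every listed bad `(q, v)` has `q = 2`, or is certified SPLIT, or has `p ∣ v`), and the kernel theorems
  `Record.hasOddErratumPrime_of_check` (⇒ `∃ q, Fact q.Prime, q ≠ 2 ∧ Mult ∧ ¬ Split ∧ p ∤ ord_q Δ_min` — EXACTLY the
  hypothesis `h` of ty2's `exists_erratumShapeField_oddDiscr_of_exists_odd`), `Record.not_hasOddErratumPrime_of_check`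
  (certificate `restOddAt` ⇒ NO odd erratum prime: an odd erratum prime is bad, hence listed, hence split or `p ∣ ord`),
  `errAt_of_errOddAt` (monotonicity), and the composition `Record.exists_erratumShapeField_oddDiscr_of_check`: for a
  certified record with the odd certificate and `r_an = 0`, the two named facts `hFH` (Friedberg–Hoffstein supply) and
  `hnf` (newform existence) give a rider-free erratum-type supply field (`2` split, `2 ∤ d_K`) — ty2's corollary applied.
* §2 the census (kernel recount = HOME/ty3/erratum/X6R0-ERRATUM-v1.tsv's odd witnesses, pure Python = PARI `a_q`):
  at `p ≥ 5` **103 of the 107 Err records carry an ODD erratum prime, 4 do not** (by prime: 78/82 @ 5, 18/18 @ 7, 4/4 @ 11,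
  3/3 @ 13 — every `q = 2`-only record is at `p = 5`); exactly one of `errOddAt` / `restOddAt` per record (734/734); the four
  `q = 2`-only `(label, p)` as a kernel list; their cross-table with the inert-pair columns: all 4 carry an inert pair with
  the unit conjunct (road (I) reaches them), 2 of 4 pass the all-`q` guard (`65774b1`, `145146q1`); at `p = 3` (record only):
  509 odd / 35 `q = 2`-only / 77 Rest of 621.
* §3 `hWeq` adapters and the cells by name: `hasOddErratumPrime_of_exists` / `not_hasOddErratumPrime_of_exists`; the four
  `q = 2`-only cells `not_hasOddErratumPrime_cell_<label>_at5` + `hasErratumPrime_cell_<label>_at5` (their Err witness is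
  `q = 2`: `a₁` odd, `a₂ + a₃` odd, `5 ∤ ord₂ Δ`); the route's T3 witness cell `hasOddErratumPrime_cell_22678e1_at5`
  (`17, 23, 29` non-split).

Two engines behind the column: HOME/ty3/erratum/X6R0-ERRATUM-v1.tsv (`err_engine1.py`, Tate's `−c₆` criterion, = PARI
`ellap` at every bad prime, 0 mismatches; column `errWitnesses`) and this kernel evaluation. beyond-print theorem: NO.
References: J. H. Silverman, *AEC* (2009) VII.5 Prop. 5.1, C.15–C.16 [SilvermanAEC2009]; F. Castella, Camb. J. Math. 6
(2018), Thm. 3.2 (arXiv:1704.06608 p. 9) [Castella2018]; Bertolini–Darmon–Prasanna, Duke Math. J. 162 (2013), Thm. 5.13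
(standing `d_K` odd) [BertoliniDarmonPrasanna2013]; Friedberg–Hoffstein, Ann. of Math. 142 (1995), Thm. B
[FriedbergHoffstein1995]; Cremona's tables [Cremona2006]; HOME/REFEREE.md R-5.1 / S-4; HOME/PLAN.md v4.2–v4.7.
-/

set_option autoImplicit false

open WeierstrassCurve NumberField Literature.NumberTheory.EllipticCurves
  Literature.NumberTheory.EllipticCurves.ModularForms
  Literature.NumberTheory.EllipticCurves.Rank1Residual
open Summit.BirchSwinnertonDyer.Rank1Residual.Supersingular (HasErratumPrime HasInertPair)

namespace Summit.BirchSwinnertonDyer.Rank1Residual.X6.PrintCert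

/-! ### §1 Record level: the odd-erratum certificates and what they prove -/

namespace Record

variable (r : Record)

/-- **Odd-erratum certificate** of a record: some listed bad `(q, v_q(Δ))` with `q ≠ 2` is certified NON-SPLIT
(`nonsplitCert`: `−c₆` a non-residue mod `q`) with `p ∤ v_q(Δ)` — the Err certificate `errAt` with the witness required odd.
[folklore] -/
def errOddAt : Bool :=
  r.bad.any fun t => decide (t.1 ≠ 2) && nonsplitCert r.ainvs t.1 && decide (¬ r.p ∣ t.2)

/-- **No-odd-erratum certificate** of a record: every listed bad `(q, v_q(Δ))` has `q = 2`, or is certified SPLIT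
(`splitAt`), or has `p ∣ v_q(Δ)` — the Rest certificate `restAt` relaxed at `q = 2`. [folklore] -/
def restOddAt : Bool :=
  r.bad.all fun t => decide (t.1 = 2) || splitAt r.ainvs t.1 || decide (r.p ∣ t.2)

/-- Monotonicity: the odd-erratum certificate implies the Err certificate. [folklore] -/
theorem errAt_of_errOddAt (h : r.errOddAt = true) : r.errAt = true := by
  obtain ⟨t, ht, hcert⟩ := List.any_eq_true.mp h
  simp only [Bool.and_eq_true] at hcert
  exact List.any_eq_true.mpr ⟨t, ht, by simp only [Bool.and_eq_true]; exact ⟨hcert.1.2, hcert.2⟩⟩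

/-- Monotonicity: the Rest certificate implies the no-odd-erratum certificate. [folklore] -/
theorem restOddAt_of_restAt (h : r.restAt = true) : r.restOddAt = true := by
  refine List.all_eq_true.mpr fun t ht => ?_
  have hcert := List.all_eq_true.mp h t ht
  simp only [Bool.or_eq_true] at hcert ⊢
  rcases hcert with hs | hd
  · exact Or.inl (Or.inr hs)
  · exact Or.inr hd

/-- **An ODD erratum prime for a certified record with the odd certificate** (kernel theorem, no claim): the listed
non-split `q ≠ 2` with `p ∤ v_q(Δ) = ord_q(Δ_min)` — in EXACTLY the hypothesis shape of ty2's
`X6RankZero.exists_erratumShapeField_oddDiscr_of_exists_odd` (`Mult W q` unfolds to `HasMultiplicativeReductionAtPrime`).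
[cite: SilvermanAEC2009, VII.5 Prop. 5.1(b)] -/
theorem hasOddErratumPrime_of_check (hc : r.check = true) [r.curve.IsElliptic] [r.curve.IsGloballyMinimal]
    (he : r.errOddAt = true) :
    ∃ q : ℕ, ∃ _ : Fact q.Prime, q ≠ 2 ∧ r.curve.HasMultiplicativeReductionAtPrime q ∧
      ¬ r.curve.HasSplitMultiplicativeReductionAtPrime q ∧ ¬ r.p ∣ padicValInt q r.curve.minimalDiscriminantInt := by
  obtain ⟨⟨q, v⟩, ht, hcert⟩ := List.any_eq_true.mp he
  simp only [Bool.and_eq_true, decide_eq_true_eq] at hcert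
  obtain ⟨⟨hq2, hns⟩, hndvd⟩ := hcert
  obtain ⟨hmult, hval⟩ := r.mult_and_val_of_mem_bad hc ht
  exact ⟨q, _, hq2, hmult, r.not_split_of_mem_bad hc ht hns, by rw [hval]; exact hndvd⟩

/-- The odd certificate gives `HasErratumPrime` (forget the parity). [cite: SilvermanAEC2009, VII.5 Prop. 5.1(b)] -/
theorem hasErratumPrime_of_errOddAt (hc : r.check = true) [r.curve.IsElliptic] [r.curve.IsGloballyMinimal]
    (he : r.errOddAt = true) : HasErratumPrime r.curve r.p :=
  r.hasErratumPrime_of_check hc (r.errAt_of_errOddAt he)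

/-- **NO odd erratum prime for a certified record with the no-odd-erratum certificate** (kernel theorem, no claim): an
odd erratum prime would be a prime of bad reduction, hence listed (`mem_badPrimes_of_not_good`), but every listed odd
prime is split-certified or has `p ∣ ord_q(Δ_min)`. [cite: SilvermanAEC2009, VII.5 Prop. 5.1(a) and (b)] -/
theorem not_hasOddErratumPrime_of_check (hc : r.check = true) [r.curve.IsElliptic] [r.curve.IsGloballyMinimal]
    (hrest : r.restOddAt = true) :
    ¬ ∃ q : ℕ, ∃ _ : Fact q.Prime, q ≠ 2 ∧ r.curve.HasMultiplicativeReductionAtPrime q ∧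
      ¬ r.curve.HasSplitMultiplicativeReductionAtPrime q ∧ ¬ r.p ∣ padicValInt q r.curve.minimalDiscriminantInt := by
  rintro ⟨q, hq, hq2, hmult, hns, hndvd⟩
  have hbad : ¬ r.curve.HasGoodReductionAtPrime q :=
    fun hgood => WeierstrassCurve.HasMultiplicativeReduction.not_hasGoodReduction (R := ℤ_[q]) hmult hgood
  have hmem := r.mem_badPrimes_of_not_good hc hq.out hbad
  obtain ⟨⟨q', v⟩, ht, htq⟩ := r.exists_mem_bad_of_mem_badPrimes hmem
  have hqq : q' = q := htq
  subst hqq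
  have hcert := List.all_eq_true.mp hrest (q', v) ht
  simp only [Bool.or_eq_true, decide_eq_true_eq] at hcert
  rcases hcert with (h2 | hs) | hdvd
  · exact hq2 h2
  · exact hns (r.split_of_mem_bad hc ht hs)
  · exact hndvd ((r.mult_and_val_of_mem_bad hc ht).2 ▸ hdvd)

/-- **The rider-free supply field of an odd-erratum record, from two named facts** (ty2's corollary applied to the
record's kernel witness): for a certified record with the odd certificate whose curve has analytic rank `0`, the
Friedberg–Hoffstein supply `hFH` and newform existence `hnf` (both NAMED published facts, taken as hypotheses) give an
odd erratum prime `q` and an imaginary quadratic `K` ramified at `q`, split at every other prime of `N` and at `2`, with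
the Heegner hypothesis at `p`, `L(E^K,1) = 0 ≠ L'(E^K,1)` for the twist, and `2 ∤ d_K`. CONDITIONAL on `hFH`, `hnf`.
[cite: FriedbergHoffstein1995, Thm. B, second alternative] [cite: Castella2018, Thm. 3.2 (arXiv:1704.06608 p. 9)]
[cite: SilvermanAEC2009, VII.5 Prop. 5.1(b)] -/
theorem exists_erratumShapeField_oddDiscr_of_check
    (hFH : friedbergHoffstein_exists_twist_simpleZero_ramifiedAt_splitAt) (hnf : exists_isNewformOf)
    (hc : r.check = true) [Fact r.p.Prime] [r.curve.IsElliptic] [r.curve.IsGloballyMinimal]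
    (he : r.errOddAt = true) (h0 : r.curve.analyticRank = 0) :
    ∃ (q : ℕ) (_ : Fact q.Prime) (K : Type) (_ : Field K) (_ : NumberField K),
      q ≠ 2 ∧ r.curve.HasMultiplicativeReductionAtPrime q ∧ ¬ r.curve.HasSplitMultiplicativeReductionAtPrime q ∧
        ¬ r.p ∣ padicValInt q r.curve.minimalDiscriminantInt ∧ q ≠ r.p ∧ q ∣ r.curve.conductorNorm ℤ ∧
      IsImaginaryQuadratic K ∧ (q : ℤ) ∣ NumberField.discr K ∧
        (∀ ℓ : ℕ, ℓ.Prime → ℓ ∣ r.curve.conductorNorm ℤ → ℓ ≠ q →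
          ((Ideal.span {(ℓ : ℤ)}).primesOver (𝓞 K)).ncard = 2) ∧
        ((Ideal.span {(2 : ℤ)}).primesOver (𝓞 K)).ncard = 2 ∧
        SatisfiesHeegnerHypothesis r.p K ∧
          (r.curve.quadraticTwist (NumberField.discr K : ℚ)).entireLFunction 1 = 0 ∧
          deriv (r.curve.quadraticTwist (NumberField.discr K : ℚ)).entireLFunction 1 ≠ 0 ∧
        ¬ (2 : ℤ) ∣ NumberField.discr K :=
  Supersingular.X6RankZero.exists_erratumShapeField_oddDiscr_of_exists_odd r.curve r.p hFH hnf
    (r.classX6_of_check hc) h0 (r.hasOddErratumPrime_of_check hc he)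

end Record

/-! ### §2 The data: the odd ∣ `q = 2`-only ∣ Rest refinement of the 734 records (the kernel re-runs the certificates) -/

/-- On every one of the 734 records EXACTLY ONE of `errOddAt` / `restOddAt` holds (so `errOddAt` decides the odd-erratum
property on the display, `hasOddErratumPrime_iff_errOddAt_of_mem`). [folklore] -/
theorem errOddAt_xor_restOddAt_allRecords : (allRecords.all fun r => r.errOddAt != r.restOddAt) = true := by
  decide +kernel

/-- **The census of the refinement at `p ≥ 5`** (two engines agree: the odd witnesses of HOME/ty3/erratum/X6R0-ERRATUM-v1.tsv
and this kernel evaluation): of the 113 records, **103 carry an ODD erratum prime**, **4 are Err with `q = 2` the only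
erratum prime**, 6 are Rest; Err = 107 = 103 + 4. The referee's S-4 numbers. [folklore] -/
theorem errOdd_counts_five_le :
    (allRecords.filter fun r => 5 ≤ r.p ∧ r.errOddAt = true).length = 103 ∧
    (allRecords.filter fun r => 5 ≤ r.p ∧ r.errAt = true ∧ r.errOddAt = false).length = 4 ∧
    (allRecords.filter fun r => 5 ≤ r.p ∧ r.errAt = true ∧ r.restOddAt = true).length = 4 ∧
    (allRecords.filter fun r => 5 ≤ r.p ∧ r.restAt = true).length = 6 ∧
    (allRecords.filter fun r => 5 ≤ r.p ∧ r.errAt = true).length = 107 := by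
  refine ⟨by decide +kernel, by decide +kernel, by decide +kernel, errRest_counts_allRecords.2.1, errRest_counts_allRecords.1⟩

/-- The refinement by prime at `p ≥ 5` — odd-erratum / Err / all: `78 / 82 / 86 @ 5`, `18 / 18 / 20 @ 7`, `4 / 4 / 4 @ 11`,
`3 / 3 / 3 @ 13`: **every `q = 2`-only Err record is at `p = 5`**; at `p ≥ 7` the odd certificate and the Err certificate
coincide pointwise. [folklore] -/
theorem errOdd_counts_by_prime :
    (allRecords.filter fun r => r.p = 5 ∧ r.errOddAt = true).length = 78 ∧
    (allRecords.filter fun r => r.p = 5 ∧ r.errAt = true).length = 82 ∧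
    (allRecords.filter fun r => r.p = 5).length = 86 ∧
    (allRecords.filter fun r => r.p = 7 ∧ r.errOddAt = true).length = 18 ∧
    (allRecords.filter fun r => r.p = 7).length = 20 ∧
    (allRecords.filter fun r => r.p = 11 ∧ r.errOddAt = true).length = 4 ∧
    (allRecords.filter fun r => r.p = 13 ∧ r.errOddAt = true).length = 3 ∧
    (allRecords.all fun r => !decide (7 ≤ r.p) || (r.errOddAt == r.errAt)) = true := by
  decide +kernel

/-- **The four `q = 2`-only Err records at `p ≥ 5`, by label** — `65774b1, 145146q1, 220022c1, 476882e1`, all at `p = 5`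
(referee census S-4; `145146q1 @ 5` is independently PROVED per pair, cell C4). [cite: Cremona2006, Table 1 (Cremona labels)] -/
theorem errTwoOnly_five_le_labels :
    ((allRecords.filter fun r => 5 ≤ r.p ∧ r.errAt = true ∧ r.errOddAt = false).map Record.label) =
      ["65774b1", "145146q1", "220022c1", "476882e1"] ∧
    ((allRecords.filter fun r => 5 ≤ r.p ∧ r.errAt = true ∧ r.errOddAt = false).map Record.p) = [5, 5, 5, 5] := by
  decide +kernel

/-- **Cross-table of the four `q = 2`-only records with the inert-pair columns** (p561444 / p574374 / p575128): all four carry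
an inert pair WITH the unit conjunct `p ∤ (ℓ₁²−1)(ℓ₂²−1)` (road (I) reaches them); exactly two (`65774b1`, `145146q1`) pass
the all-`q` guard `∀ q ∣ N, p ∤ q² − 1`, two (`220022c1`: `11 ≡ 1`; `476882e1`: `1481 ≡ 1 (mod 5)`) do not. [folklore] -/
theorem errTwoOnly_five_le_inertPair_columns :
    (allRecords.all fun r =>
      !(decide (5 ≤ r.p) && r.errAt && !r.errOddAt) || (r.inertPairAt && r.inertPairCoprimeAt)) = true ∧
    ((allRecords.filter fun r => 5 ≤ r.p ∧ r.errAt = true ∧ r.errOddAt = false ∧ r.prasannaGuardAt = true).map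
      Record.label) = ["65774b1", "145146q1"] ∧
    ((allRecords.filter fun r => 5 ≤ r.p ∧ r.errAt = true ∧ r.errOddAt = false ∧ r.prasannaGuardAt = false).map
      Record.label) = ["220022c1", "476882e1"] := by
  decide +kernel

/-- The odd-erratum column over the whole `p ≥ 5` census against Err ∣ Rest: odd ⊆ Err (103 ⊆ 107), Rest ⊆ no-odd (6 ⊆ 10),
and the 10 records without an odd erratum prime = 4 Err + 6 Rest. [folklore] -/
theorem errOdd_nesting_five_le :
    (allRecords.all fun r => !r.errOddAt || r.errAt) = true ∧
    (allRecords.all fun r => !r.restAt || r.restOddAt) = true ∧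
    (allRecords.filter fun r => 5 ≤ r.p ∧ r.restOddAt = true).length = 10 := by
  decide +kernel

/-- At `p = 3` (record only — road (E) is `p ≥ 5`): 509 odd-erratum / 35 `q = 2`-only Err / 77 Rest of the 621 records.
[folklore] -/
theorem errOdd_counts_three :
    (allRecords.filter fun r => r.p = 3 ∧ r.errOddAt = true).length = 509 ∧
    (allRecords.filter fun r => r.p = 3 ∧ r.errAt = true ∧ r.errOddAt = false).length = 35 ∧
    (allRecords.filter fun r => r.p = 3 ∧ r.restAt = true).length = 77 := by
  refine ⟨by decide +kernel, by decide +kernel, errRest_counts_allRecords.2.2.2⟩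

/-! ### §3 The display: the odd-erratum property decided for every listed pair -/

/-- **An odd erratum prime for a listed pair with the odd certificate** (kernel theorem per record; instance binders from the
recheck). [cite: SilvermanAEC2009, VII.5 Prop. 5.1(b)] -/
theorem hasOddErratumPrime_of_mem (r : Record) (hr : r ∈ allRecords) (he : r.errOddAt = true) :
    haveI := (r.elliptic_and_minimal_of_check (check_of_mem_of_certified certified_allRecords hr)).1
    haveI := (r.elliptic_and_minimal_of_check (check_of_mem_of_certified certified_allRecords hr)).2
    ∃ q : ℕ, ∃ _ : Fact q.Prime, q ≠ 2 ∧ r.curve.HasMultiplicativeReductionAtPrime q ∧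
      ¬ r.curve.HasSplitMultiplicativeReductionAtPrime q ∧ ¬ r.p ∣ padicValInt q r.curve.minimalDiscriminantInt := by
  have hc := check_of_mem_of_certified certified_allRecords hr
  haveI := (r.elliptic_and_minimal_of_check hc).1
  haveI := (r.elliptic_and_minimal_of_check hc).2
  exact r.hasOddErratumPrime_of_check hc he

/-- **No odd erratum prime for a listed pair with the no-odd certificate** (kernel theorem per record).
[cite: SilvermanAEC2009, VII.5 Prop. 5.1(a) and (b)] -/
theorem not_hasOddErratumPrime_of_mem (r : Record) (hr : r ∈ allRecords) (hrest : r.restOddAt = true) :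
    haveI := (r.elliptic_and_minimal_of_check (check_of_mem_of_certified certified_allRecords hr)).1
    haveI := (r.elliptic_and_minimal_of_check (check_of_mem_of_certified certified_allRecords hr)).2
    ¬ ∃ q : ℕ, ∃ _ : Fact q.Prime, q ≠ 2 ∧ r.curve.HasMultiplicativeReductionAtPrime q ∧
      ¬ r.curve.HasSplitMultiplicativeReductionAtPrime q ∧ ¬ r.p ∣ padicValInt q r.curve.minimalDiscriminantInt := by
  have hc := check_of_mem_of_certified certified_allRecords hr
  haveI := (r.elliptic_and_minimal_of_check hc).1
  haveI := (r.elliptic_and_minimal_of_check hc).2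
  exact r.not_hasOddErratumPrime_of_check hc hrest

/-- On the display the two certificates are complementary: each listed record carries exactly one. [folklore] -/
theorem errOddAt_or_restOddAt_of_mem (r : Record) (hr : r ∈ allRecords) :
    (r.errOddAt = true ∧ r.restOddAt = false) ∨ (r.errOddAt = false ∧ r.restOddAt = true) := by
  have hx := List.all_eq_true.mp errOddAt_xor_restOddAt_allRecords r hr
  revert hx
  cases r.errOddAt <;> cases r.restOddAt <;> decide

/-- **The odd-erratum property is DECIDED on the display**: for a listed pair, `(∃ odd erratum prime) ↔ errOddAt`.
[cite: SilvermanAEC2009, VII.5 Prop. 5.1(a) and (b)] -/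
theorem hasOddErratumPrime_iff_errOddAt_of_mem (r : Record) (hr : r ∈ allRecords) :
    haveI := (r.elliptic_and_minimal_of_check (check_of_mem_of_certified certified_allRecords hr)).1
    haveI := (r.elliptic_and_minimal_of_check (check_of_mem_of_certified certified_allRecords hr)).2
    (∃ q : ℕ, ∃ _ : Fact q.Prime, q ≠ 2 ∧ r.curve.HasMultiplicativeReductionAtPrime q ∧
      ¬ r.curve.HasSplitMultiplicativeReductionAtPrime q ∧ ¬ r.p ∣ padicValInt q r.curve.minimalDiscriminantInt) ↔
      r.errOddAt = true := by
  rcases errOddAt_or_restOddAt_of_mem r hr with ⟨he, -⟩ | ⟨he, hrest⟩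
  · exact ⟨fun _ => he, fun _ => hasOddErratumPrime_of_mem r hr he⟩
  · refine ⟨fun h => absurd h (not_hasOddErratumPrime_of_mem r hr hrest), fun h => ?_⟩
    rw [he] at h
    exact absurd h Bool.false_ne_true

/-! ### §4 `hWeq` adapters and the cells by name -/

section Adapters

variable {rs : List Record} {W : WeierstrassCurve ℚ} [W.IsElliptic] [W.IsGloballyMinimal] {a1 a2 a3 a4 a6 : ℤ} {p : ℕ}

/-- **An odd erratum prime in the `hWeq` shape** from a certified list containing a record with these a-invariants, this `p`,
and the odd certificate (membership `by decide +kernel` in the part `recordsNN` holding the label).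
[cite: SilvermanAEC2009, VII.5 Prop. 5.1(b)] -/
theorem hasOddErratumPrime_of_exists (hrs : certified rs = true)
    (h : ∃ r ∈ rs, r.ainvs = [a1, a2, a3, a4, a6] ∧ r.p = p ∧ r.errOddAt = true) (hWeq : W = ⟨a1, a2, a3, a4, a6⟩) :
    ∃ q : ℕ, ∃ _ : Fact q.Prime, q ≠ 2 ∧ W.HasMultiplicativeReductionAtPrime q ∧
      ¬ W.HasSplitMultiplicativeReductionAtPrime q ∧ ¬ p ∣ padicValInt q W.minimalDiscriminantInt := by
  obtain ⟨r, hr, hA, hp, he⟩ := h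
  have hc := check_of_mem_of_certified hrs hr
  have hW : W = r.curve := by rw [hWeq]; exact r.curve_eq hA
  subst hW
  subst hp
  exact r.hasOddErratumPrime_of_check hc he

/-- **No odd erratum prime in the `hWeq` shape** from a certified list containing a record with these a-invariants, this `p`,
and the no-odd certificate. [cite: SilvermanAEC2009, VII.5 Prop. 5.1(a) and (b)] -/
theorem not_hasOddErratumPrime_of_exists (hrs : certified rs = true)
    (h : ∃ r ∈ rs, r.ainvs = [a1, a2, a3, a4, a6] ∧ r.p = p ∧ r.restOddAt = true) (hWeq : W = ⟨a1, a2, a3, a4, a6⟩) :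
    ¬ ∃ q : ℕ, ∃ _ : Fact q.Prime, q ≠ 2 ∧ W.HasMultiplicativeReductionAtPrime q ∧
      ¬ W.HasSplitMultiplicativeReductionAtPrime q ∧ ¬ p ∣ padicValInt q W.minimalDiscriminantInt := by
  obtain ⟨r, hr, hA, hp, hrest⟩ := h
  have hc := check_of_mem_of_certified hrs hr
  have hW : W = r.curve := by rw [hWeq]; exact r.curve_eq hA
  subst hW
  subst hp
  exact r.not_hasOddErratumPrime_of_check hc hrest

end Adapters

section Cells

variable {W : WeierstrassCurve ℚ} [W.IsElliptic] [W.IsGloballyMinimal]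

/-- `65774b1 @ 5` (`N = 2·32887`, bad `(2,26), (32887,1)`; `2` non-split, `32887` split): Err, but NO odd erratum prime.
[cite: Cremona2006, Table 1 (Cremona label 65774b1)] -/
theorem not_hasOddErratumPrime_cell_65774b1_at5 (hWeq : W = ⟨1, 1, 0, -2045, -80707⟩) :
    ¬ ∃ q : ℕ, ∃ _ : Fact q.Prime, q ≠ 2 ∧ W.HasMultiplicativeReductionAtPrime q ∧
      ¬ W.HasSplitMultiplicativeReductionAtPrime q ∧ ¬ 5 ∣ padicValInt q W.minimalDiscriminantInt :=
  not_hasOddErratumPrime_of_exists certified_records14 (by decide +kernel) hWeq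

/-- `65774b1 @ 5`: its Err witness is `q = 2` (`HasErratumPrime W 5`). [cite: Cremona2006, Table 1 (Cremona label 65774b1)] -/
theorem hasErratumPrime_cell_65774b1_at5 (hWeq : W = ⟨1, 1, 0, -2045, -80707⟩) : HasErratumPrime W 5 :=
  hasErratumPrime_of_exists certified_records14 (by decide +kernel) hWeq

/-- `145146q1 @ 5` (bad `(2,27), (3,10), (17,1), (1423,1)`; `2` non-split, the rest split; cell C4, PROVED per pair): Err, NO odd
erratum prime. [cite: Cremona2006, Table 1 (Cremona label 145146q1)] -/
theorem not_hasOddErratumPrime_cell_145146q1_at5 (hWeq : W = ⟨1, 0, 1, -3229945761, -70654953055340⟩) :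
    ¬ ∃ q : ℕ, ∃ _ : Fact q.Prime, q ≠ 2 ∧ W.HasMultiplicativeReductionAtPrime q ∧
      ¬ W.HasSplitMultiplicativeReductionAtPrime q ∧ ¬ 5 ∣ padicValInt q W.minimalDiscriminantInt :=
  not_hasOddErratumPrime_of_exists certified_records14 (by decide +kernel) hWeq

/-- `145146q1 @ 5`: its Err witness is `q = 2`. [cite: Cremona2006, Table 1 (Cremona label 145146q1)] -/
theorem hasErratumPrime_cell_145146q1_at5 (hWeq : W = ⟨1, 0, 1, -3229945761, -70654953055340⟩) :
    HasErratumPrime W 5 :=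
  hasErratumPrime_of_exists certified_records14 (by decide +kernel) hWeq

/-- `220022c1 @ 5` (bad `(2,48), (11,4), (73,1), (137,2)`; `2` non-split, the rest split): Err, NO odd erratum prime.
[cite: Cremona2006, Table 1 (Cremona label 220022c1)] -/
theorem not_hasOddErratumPrime_cell_220022c1_at5 (hWeq : W = ⟨1, -1, 0, -766181797, -8161933796331⟩) :
    ¬ ∃ q : ℕ, ∃ _ : Fact q.Prime, q ≠ 2 ∧ W.HasMultiplicativeReductionAtPrime q ∧
      ¬ W.HasSplitMultiplicativeReductionAtPrime q ∧ ¬ 5 ∣ padicValInt q W.minimalDiscriminantInt :=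
  not_hasOddErratumPrime_of_exists certified_records14 (by decide +kernel) hWeq

/-- `220022c1 @ 5`: its Err witness is `q = 2`. [cite: Cremona2006, Table 1 (Cremona label 220022c1)] -/
theorem hasErratumPrime_cell_220022c1_at5 (hWeq : W = ⟨1, -1, 0, -766181797, -8161933796331⟩) :
    HasErratumPrime W 5 :=
  hasErratumPrime_of_exists certified_records14 (by decide +kernel) hWeq

/-- `476882e1 @ 5` (bad `(2,17), (7,1), (23,3), (1481,3)`; `2` non-split, the rest split): Err, NO odd erratum prime.
[cite: Cremona2006, Table 1 (Cremona label 476882e1)] -/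
theorem not_hasOddErratumPrime_cell_476882e1_at5 (hWeq : W = ⟨1, 0, 1, 220814, 286977796⟩) :
    ¬ ∃ q : ℕ, ∃ _ : Fact q.Prime, q ≠ 2 ∧ W.HasMultiplicativeReductionAtPrime q ∧
      ¬ W.HasSplitMultiplicativeReductionAtPrime q ∧ ¬ 5 ∣ padicValInt q W.minimalDiscriminantInt :=
  not_hasOddErratumPrime_of_exists certified_records15 (by decide +kernel) hWeq

/-- `476882e1 @ 5`: its Err witness is `q = 2`. [cite: Cremona2006, Table 1 (Cremona label 476882e1)] -/
theorem hasErratumPrime_cell_476882e1_at5 (hWeq : W = ⟨1, 0, 1, 220814, 286977796⟩) : HasErratumPrime W 5 :=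
  hasErratumPrime_of_exists certified_records15 (by decide +kernel) hWeq

/-- The route's T3 witness cell `22678e1 @ 5` (bad `2, 17, 23, 29`; `17, 23, 29` non-split with `ord = 1, 1, 4`): an ODD
erratum prime. [cite: Cremona2006, Table 1 (Cremona label 22678e1)] -/
theorem hasOddErratumPrime_cell_22678e1_at5 (hWeq : W = ⟨1, 0, 0, 3140254662, -139987982322460⟩) :
    ∃ q : ℕ, ∃ _ : Fact q.Prime, q ≠ 2 ∧ W.HasMultiplicativeReductionAtPrime q ∧
      ¬ W.HasSplitMultiplicativeReductionAtPrime q ∧ ¬ 5 ∣ padicValInt q W.minimalDiscriminantInt :=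
  hasOddErratumPrime_of_exists certified_records14 (by decide +kernel) hWeq

end Cells

/-! ### §5 (appended, gen 7) The two PRINT-candidate keys of PLAN v4.8b on the census: ErrOdd ∪ narrowed inert pair -/
/-- **Coverage of the `p ≥ 5` census by the two refined class keys of PLAN v4.8b** (children5 v2: `ErrOdd` =
`HasOddErratumPrime`, certificate `errOddAt`; `RestPairGuard` = the inert pair WITH the pair-local unit conjunct
`p ∤ (ℓ₁²−1)(ℓ₂²−1)`, certificate `inertPairCoprimeAt`, p574374): of the 113 records, **111 carry at least one of the two
certificates** (95 both; 8 only the odd-erratum one — the eight Err records with a single usable prime, p574374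
`noInertPairCoprime_five_le_labels`; 8 only the narrowed pair — the four `q = 2`-only Err records and the Rest keepers
`138594b1, 331554a1 @ 5`, `12927e1, 399190l1 @ 7`), and **exactly two carry neither: the Rest records `246697a1, 321518d1 @ 5`**
(both `restAt`, at `p = 5`) = the census support of the refined residual `RestThinGuard` (= p574374 `noInertPairCoprime_rest_labels`;
both independently PROVED per pair on the director's book). By prime: 84/86 @ 5, 20/20 @ 7, 4/4 @ 11, 3/3 @ 13. [folklore] -/
theorem errOdd_or_inertPairCoprime_counts_five_le :
    (allRecords.filter fun r => 5 ≤ r.p ∧ (r.errOddAt || r.inertPairCoprimeAt) = true).length = 111 ∧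
    (allRecords.filter fun r => 5 ≤ r.p ∧ r.errOddAt = true ∧ r.inertPairCoprimeAt = true).length = 95 ∧
    (allRecords.filter fun r => 5 ≤ r.p ∧ r.errOddAt = true ∧ r.inertPairCoprimeAt = false).length = 8 ∧
    (allRecords.filter fun r => 5 ≤ r.p ∧ r.errOddAt = false ∧ r.inertPairCoprimeAt = true).length = 8 ∧
    ((allRecords.filter fun r => 5 ≤ r.p ∧ r.errOddAt = false ∧ r.inertPairCoprimeAt = false).map Record.label) =
      ["246697a1", "321518d1"] ∧
    ((allRecords.filter fun r => 5 ≤ r.p ∧ r.errOddAt = false ∧ r.inertPairCoprimeAt = false).all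
      fun r => r.p == 5 && r.restAt) = true ∧
    (allRecords.filter fun r => r.p = 5 ∧ (r.errOddAt || r.inertPairCoprimeAt) = true).length = 84 ∧
    (allRecords.all fun r => !decide (7 ≤ r.p) || (r.errOddAt || r.inertPairCoprimeAt)) = true := by
  decide +kernel

/-- The «only the narrowed pair» octet by label: the four `q = 2`-only Err records and four Rest records. [cite: Cremona2006, Table 1] -/
theorem inertPairCoprime_not_errOdd_five_le_labels :
    ((allRecords.filter fun r => 5 ≤ r.p ∧ r.errOddAt = false ∧ r.inertPairCoprimeAt = true).map Record.label) =
      ["65774b1", "138594b1", "145146q1", "220022c1", "331554a1", "476882e1", "12927e1", "399190l1"] := by decide +kernel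

end Summit.BirchSwinnertonDyer.Rank1Residual.X6.PrintCert
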